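import Literature.MathematicalPhysics.QuantumFieldTheory.Balaban1983to89.B13WeightedInverseLettersOnCoerciveBall
import Literature.MathematicalPhysics.QuantumFieldTheory.Balaban1983to89.B13XinvCentreDecayOfReg335
import Literature.MathematicalPhysics.QuantumFieldTheory.Balaban1983to89.B9Thm39CubeOpsAtLettersY
import Literature.MathematicalPhysics.QuantumFieldTheory.Balaban1983to89.Node00.OpsYDeltaALocal

/-!
# `Balaban1983to89.B13DirichletLocalCLetters` — T. Bałaban, *Propagators for lattice gauge theories in a background field*, Commun. Math. Phys. **99** (1985) 389–434
# [Balaban1985BackgroundPropagators], (3.25) p. 394, Thm 3.2 (3.48) p. 398, Thm 3.4 p. 400, (3.66)–(3.70) pp. 403–404, Sect. C pp. 408–409 («The operators constructed for this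
# sequence, which we denote by G′_□(U), C_□(U) = (Q′(U)G′_□²(U)Q′*(U))⁻¹, G_□(U), satisfy all the inequalities of Theorems 3.1–3.3»), (3.87) p. 409, (3.95)–(3.96) p. 411,
# Thm 3.10 (3.107)–(3.108) p. 416, Thm 3.11 p. 416; [Balaban1984PropagatorsI] p. 25 («⟨ω, Q′G′²Q′*ω⟩ = ‖G′Q′*ω‖²»); [Balaban1984PropagatorsII] Prop 2.3 p. 238, (2.54) p. 232,
# Lemma 2.1 (2.61) p. 234, (2.69) p. 235; [Balaban1988RG2Cluster] (2.5)–(2.7) pp. 12–13, p. 15: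
# ★★★ STATION L2 OF THE LOCAL-CUBE ROAD, THE `C_□` HALF — the LOCATED CENTRE (the padded compression of `X_□(U) = Q′G′_□²Q′*(U)` to the cube's blocks is
# `(4(d+1)+1)⁻²`-coercive in the block-volume pairing at EVERY unitary-valued `U`, regime-free) and the letters of `u ↦ C_□(F u)` on the whole coercivity ball from
# `X_□`'s — dag-n10-w6 g4's L3 INPUT `hC` verbatim; along pv27's pencil at def-Y's v4 letter around every `G`-valued background, fed by `G′_□`'s pencil letters (L1's
# OUTPUT `hG`), with NO displayed N06 hypothesis.

[folklore] bookkeeping + compositions of cited tree theorems BY NAME (r05's `B9Thm39CubeOpsAtLettersY` §1, n06-w1's `B9Thm31SiteGsqBoundsReg335Y` ∕ `B9Thm32SiteXBoundsY`,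
this seat's `B13XinvCentreDecayOfReg335` §2 (w2's X-station at the v4 letter) and `B13WeightedInverseLettersOnCoerciveBall` (module 84 in the block-volume pairing under the
Dirichlet compression, over w3's L1)); THEOREMS ONLY (no `def`, no `structure`, no instance, no notation); NOTHING of NODE 00's ∕ N06's is modified or restated; nothing here
is a claim about the Yang–Mills mass gap; no node is discharged; count-neutral.

WHY THIS FILE (cell `pub-ymgap`, HUMAN RULING D-0062, Track A node N10 = [B13]; seat `pub-ymgap-dag-n10-w5` g4; the local-cube road of dag-n10-w3 g5, census v21.1 item 5,
lane GO I.37967 ∕ fan-out I.38258: L1 w3 · L2 w5 · L3 w6 · L4∕L5 w3).  The v4 inverse road `G′ → X⁻¹ → R → Δ_a → G` (w2∕w4∕w5∕w6, modules 83∕84) is typed for NODE 00's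
GLOBAL letters; print (p. 416) and N06's row-17 road go through the LOCAL cube operators of Sect. C.  def-Y's letters: `X_□(U) = XY i parS (GsqY i parS D) U`,
`padXlocY = dirPadY P X_□`, `C_□(U) = ClocY i parS D P U = P·(P X_□(U) P + 1 − P)⁻¹·P` (`Node00.OpsYDeltaALocal`).  `X_□` is `W`-symmetric, NOT flat-symmetric, and
coercive on the cube's blocks only (`G′_□` vanishes off □̃) — hence module 84 is read in the `W`-pairing with the compression's centre (`B13WeightedInverseLettersOnCoerciveBall`).

WHAT THIS FILE PROVES (all `theorem`s; `𝔸 = M_N(ℂ)`, `B_S ∕ B_B` = the product bases of matrix units over sites ∕ blocks).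
* §1 `trIP_self_eq_cut_add_compl` (Pythagoras for a 0∕1 cut, any weight), ★★ `trIP_padXlocY_parSymY_ge` — THE LOCATED CENTRE, REGIME-FREE: at EVERY `G`-valued `U`
  (`G ≤ U(N)`) and every block set `Dblk` whose sites lie in `D`, `(4(d+1)+1)⁻²·⟨Ψ,Ψ⟩_W ≤ ⟨Ψ, (𝟙_{Dblk} X_□(U) 𝟙_{Dblk} + 1 − 𝟙_{Dblk})Ψ⟩_W` for ALL block functions `Ψ`
  (r05 `trIP_XY_GsqY_parSymY_eq` ∕ `cubeProjY_QpsY_cutMulY`, n06-w1's local floor `trIP_cubeProjY_self_le_GsqY_parSymY`, Cauchy–Schwarz, the isometry `‖Q′*g‖₁ = ‖g‖_W`,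
  Pythagoras) — the QUANTITATIVE twin of r05's `posDefTr_padX_parSymY` with n06-w1's global constant `trIP_XY_parSymY_ge`; NO (3.35), NO smallness.
* §2 the block-volume numerals `one_le_wB`, `wB_le_pow`, `sqrt_wB_le` (`√W ≤ Θ := √((L^k)^{d+1})`), `inv_sqrt_wB_le_one`; ★★★ `rawEntryLetters_toMatrix_ClocY_of_family` —
  THE `C_□`-STATION ALONG ANY FAMILY `F : E → CfgY` (ANY `parS`, `D`, 0∕1 block cut `χ`): `X_□`'s letters `(R, ρ, B_X)` along `F` (displayed; §X-station of
  `B13DirichletLocalXLetters` from L1's `hG`), a fibre bound, the centre's coercivity `m` of the padded compression at `F 0` in the `W`-pairing (displayed) and the window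
  ⟹ `RawEntryLetters (u ↦ toMatrix B_B B_B (ClocY i parS D (M_χ) (F u))) (ℓB ∘ fst) R′ κ (1·Θ·4∕m′)`, `m′ = m − 2·((Θ·1·(B_X+1))·(m_B·c₀(1,ρ)^ν))·R′∕R` — w6's L3 INPUT
  `hC` VERBATIM at `P := cutMulY χ`; ★★★ `rawEntryLetters_toMatrix_ClocY_parSymY_prodCfg_of_XLetters` (pv27's pencil, v4 letter `parSymY`, ANY `G`-valued `U₀`: the centre
  DISCHARGED by §1, `m = (4(d+1)+1)⁻²`); ★★★ `rawEntryLetters_toMatrix_ClocY_parSymY_prodCfg_of_GsqLetters` (fed by `G′_□`'s pencil letters `hG` through this seat's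
  `rawEntryLetters_toMatrix_XY_parSymY_prodCfg_of_mem` at `Gp := GsqY i parSymY D` — L1's OUTPUT in, L3's INPUT out; NO (3.35), NO N06 hypothesis displayed).
HONEST FRAMING: [folklore] bookkeeping + compositions; `G′_□`'s ∕ `X_□`'s letters are DISPLAYED (L1's ∕ the X-station's output); the ball is in the CHART around `U₀`, not
print's class (3.35); finite-lattice constants (`Θ` from the block-volume pairing), not print's `O(1)`; print's multi-scale rate (3.48) NOT claimed; which readings ∕ `η` ∕
`U₀` are «of record» is NODE 00's ∕ def-T's word; nothing of Bałaban's asserted beyond the cited theorems; N06 ∕ N10 NOT discharged; K1⁹ NOT closed; counts unmoved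
(typed 28∕28 · discharged 5∕27); 0 `def`, 0 `sorry`, standard axioms; one finite 𝕋⁴ programme at fixed ε — R4 closes the conditional finite-𝕋⁴ rung `BalabanLadder.UV`
only; the YM mass gap (Clay) is NOT proved by any of this; nothing continuum ∕ ℝ⁴ ∕ OS.  Filed `--kind proof --supports` K1⁹ (stmt-QuantumFields-27364), Literature lane.
-/

noncomputable section

namespace Literature.MathematicalPhysics.QuantumFieldTheory.Balaban1983to89.B13DirichletLocalCLetters

open Metric Set Finset Module
open scoped Matrix Matrix.Norms.L2Operator
open Literature.MathematicalPhysics.QuantumFieldTheory.Balaban1983to89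
open Literature.MathematicalPhysics.QuantumFieldTheory.Balaban1983to89.B9Thm37GlueTorus (tdist1)
open Literature.MathematicalPhysics.QuantumFieldTheory.Balaban1983to89.B5TorusCover (UT)
open Literature.MathematicalPhysics.QuantumFieldTheory.Balaban1983to89.B9Thm311ReadingCoords (trIP)
open Literature.MathematicalPhysics.QuantumFieldTheory.Balaban1983to89.B13EntrywiseWalks (RawEntryLetters)
open Literature.MathematicalPhysics.QuantumFieldTheory.Balaban1983to89.B9Thm37CubeCoverCommutators (cutMulY cutMulY_apply cutMulY_mul cutMulY_one)
open Literature.MathematicalPhysics.QuantumFieldTheory.Balaban1983to89.B9Thm311DeltaPrimePos (trIP_self_nonneg trIP_add_right)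
open Literature.MathematicalPhysics.QuantumFieldTheory.Balaban1983to89.B9Thm31SiteGpBoundsReg335Y (trIP_sq_le)
open Literature.MathematicalPhysics.QuantumFieldTheory.Balaban1983to89.B9Thm311ReadingAtLetters (wB wB_pos)
open Literature.MathematicalPhysics.QuantumFieldTheory.Balaban1983to89.B9Thm311PosViaLocalInversesY (trIP_dirPadY_cutMulY_eq trIP_cutMulY_cutMulY)
open Literature.MathematicalPhysics.QuantumFieldTheory.Balaban1983to89.B9Thm39CubeOpsAtLettersY (blkIndY blkIndY_zero_one cubeProjY_QpsY_cutMulY trIP_XY_GsqY_parSymY_eq)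
open Literature.MathematicalPhysics.QuantumFieldTheory.Balaban1983to89.B9Thm31SiteGsqBoundsReg335Y (trIP_cubeProjY_self_le_GsqY_parSymY)
open Literature.MathematicalPhysics.QuantumFieldTheory.Balaban1983to89.B9Thm32SiteXBoundsY (trIP_one_QpsY_self_eq)
open Literature.MathematicalPhysics.QuantumFieldTheory.Balaban1983to89.B13XinvCentreDecayOfReg335 (rawEntryLetters_toMatrix_XY_parSymY_prodCfg_of_mem)
open Literature.MathematicalPhysics.QuantumFieldTheory.Balaban1983to89.B13WeightedInverseLettersOnCoerciveBall (rawEntryLetters_toMatrix_dirInvY_of_coer_compression_letters_weighted)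
open Literature.MathematicalPhysics.QuantumFieldTheory.Balaban1983to89.B9Eq39Adjoint (prodCfg)
open Literature.MathematicalPhysics.QuantumFieldTheory.Balaban1983to89.B9Eq369Product (prodCfg_zero)
open Literature.MathematicalPhysics.QuantumFieldTheory.Balaban1983to89.B6GlobalChartV1 (PV boxEquiv)
open Literature.MathematicalPhysics.QuantumFieldTheory.Balaban1983to89.B6KLevelCensusIndexV1 (KIdx)
open Literature.MathematicalPhysics.QuantumFieldTheory.Balaban1983to89.B6Geom246MultiLevelBox (blkOf)
open Literature.MathematicalPhysics.QuantumFieldTheory.Balaban1983to89.Node00.OpsYLocalInverse (dirPadY dirInvY GsqY cubeProjY)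
open Literature.MathematicalPhysics.QuantumFieldTheory.Balaban1983to89.Node00.OpsYDeltaALocal (padXlocY ClocY)
open Literature.MathematicalPhysics.QuantumFieldTheory.Balaban1983to89.Node00

/-! ## §1. ★★ The located centre: the padded compression of `X_□(U) = Q′G′_□²Q′*(U)` to the cube's blocks is UNIFORMLY coercive at every unitary-valued background -/

section Centre

variable {d ℓ : ℕ} {hd : 1 ≤ d + 1} {hL : Odd (ℓ + 1) ∧ 1 < ℓ + 1} {b₀ b₁ : ℝ} {N : ℕ}
variable (i : KIdx d ℓ hd hL b₀ b₁) {G : Subgroup (Matrix (Fin N) (Fin N) ℂ)ˣ}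

/-- Pythagoras for a 0∕1 cut: `⟨Ψ,Ψ⟩_w = ⟨M_χΨ, M_χΨ⟩_w + ⟨M_{1−χ}Ψ, M_{1−χ}Ψ⟩_w`. [cite: Balaban1985BackgroundPropagators, p.393 (scalar products), (3.87) p.409, bookkeeping] -/
theorem trIP_self_eq_cut_add_compl {X : Type} [Fintype X] (w : X → ℝ) {χ : X → ℝ} (hχ : ∀ z, χ z = 0 ∨ χ z = 1)
    (Ψ : X → Matrix (Fin N) (Fin N) ℂ) :
    trIP w Ψ Ψ = trIP w (cutMulY χ Ψ) (cutMulY χ Ψ) + trIP w (cutMulY (fun z => 1 - χ z) Ψ) (cutMulY (fun z => 1 - χ z) Ψ) := by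
  have hχ2 : (fun z => χ z * χ z) = χ := funext fun z => by rcases hχ z with h | h <;> simp [h]
  have hχ2' : (fun z => (1 - χ z) * (1 - χ z)) = fun z => 1 - χ z := funext fun z => by rcases hχ z with h | h <;> simp [h]
  rw [trIP_cutMulY_cutMulY, trIP_cutMulY_cutMulY, hχ2, hχ2', ← trIP_add_right,
    B9Thm311PosViaLocalInversesY.cutMulY_add_compl]

/-- ★★ **THE LOCATED CENTRE, REGIME-FREE.**  At EVERY `G`-valued background `U` (`G ≤ U(N)`) and for every block set `Dblk` whose sites lie in the cube's
site set `D` (□ ⊆ □̃): `(4(d+1)+1)⁻²·⟨Ψ,Ψ⟩_W ≤ ⟨Ψ, (𝟙_□ X_□(U) 𝟙_□ + 1 − 𝟙_□)Ψ⟩_W` for ALL block functions `Ψ` — the padded compression of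
`X_□(U) = Q′G′_□²Q′*(U)` to the cube's blocks is UNIFORMLY coercive in the block-volume pairing, with the constant of n06-w1's global `trIP_XY_parSymY_ge`
(`⟨𝟙_□Ψ, X_□ 𝟙_□Ψ⟩_W = ‖G′_□Q′*𝟙_□Ψ‖²₁`, `Q′*𝟙_□Ψ` supported in □̃, the local floor `‖P_□̃ξ‖²₁ ≤ (4(d+1)+1)·⟨ξ, G′_□ξ⟩₁`, Cauchy–Schwarz, the isometry
`‖Q′*g‖₁ = ‖g‖_W`, Pythagoras for the cut) — the QUANTITATIVE twin of r05's `posDefTr_padX_parSymY`; NO (3.35), NO smallness, no N06 input.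
[cite: Balaban1985BackgroundPropagators, (3.25) p.394, Thm 3.2 p.398, (3.87) p.409 (C_□ = (Q′G′_□²Q′*)⁻¹), Thm 3.11 p.416; Balaban1984PropagatorsI, p.25;
Balaban1984PropagatorsII, Prop 2.3 p.238, (2.69) p.235] -/
theorem trIP_padXlocY_parSymY_ge (hG : G ≤ B7Prop2Explicit.unitaryUnits (Matrix (Fin N) (Fin N) ℂ))
    {U : CfgY (Matrix (Fin N) (Fin N) ℂ) i} (hU : ∀ μ x, U μ x ∈ G) {D : Finset (SiteY i)} {Dblk : Finset (BlkY i)}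
    (hDD : ∀ z : SiteY i, blkOf i.D.toDomains z ∈ Dblk → z ∈ D) (Ψ : BlkY i → Matrix (Fin N) (Fin N) ℂ) :
    ((4 * ((d : ℝ) + 1) + 1) ^ 2)⁻¹ * trIP (wB i) Ψ Ψ ≤
      trIP (wB i) Ψ (padXlocY i (parSymY i) D (cutMulY (blkIndY i Dblk)) U Ψ) := by
  have hχ := blkIndY_zero_one i Dblk
  have hM0 : (0 : ℝ) < 4 * ((d : ℝ) + 1) + 1 := by positivity
  have hM1 : (1 : ℝ) ≤ 4 * ((d : ℝ) + 1) + 1 := by nlinarith [(Nat.cast_nonneg d : (0 : ℝ) ≤ d)]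
  have hMi1 : ((4 * ((d : ℝ) + 1) + 1) ^ 2)⁻¹ ≤ 1 := inv_le_one_of_one_le₀ (one_le_pow₀ hM1)
  -- the form of the padded compression splits along the cut
  simp only [padXlocY]
  rw [trIP_dirPadY_cutMulY_eq (wB i) hχ, trIP_XY_GsqY_parSymY_eq i hG hU D]
  set Φ : BlkY i → Matrix (Fin N) (Fin N) ℂ := cutMulY (blkIndY i Dblk) Ψ with hΦ
  set Ψc : BlkY i → Matrix (Fin N) (Fin N) ℂ := cutMulY (fun z => 1 - blkIndY i Dblk z) Ψ with hΨc
  set ξ : SiteY i → Matrix (Fin N) (Fin N) ℂ := QpsY i (parSymY i) U Φ with hξ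
  -- `Q′*Φ` is supported in □̃, so the local floor applies to it
  have hsupp : cubeProjY i D ξ = ξ := cubeProjY_QpsY_cutMulY i (parSymY i) U hDD Ψ
  have hfloor : trIP (fun _ => (1 : ℝ)) ξ ξ ≤ (4 * ((d : ℝ) + 1) + 1) * trIP (fun _ => (1 : ℝ)) ξ (GsqY i (parSymY i) D U ξ) := by
    have h := trIP_cubeProjY_self_le_GsqY_parSymY i hG hU D ξ
    rwa [hsupp] at h
  -- Cauchy–Schwarz: `‖ξ‖² ≤ M²‖G′_□ξ‖²`
  have hcs : trIP (fun _ => (1 : ℝ)) ξ ξ ≤ (4 * ((d : ℝ) + 1) + 1) ^ 2 *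
      trIP (fun _ => (1 : ℝ)) (GsqY i (parSymY i) D U ξ) (GsqY i (parSymY i) D U ξ) := by
    have ha : 0 ≤ trIP (fun _ => (1 : ℝ)) ξ ξ := trIP_self_nonneg _ (fun _ => one_pos) ξ
    have hb : 0 ≤ trIP (fun _ => (1 : ℝ)) (GsqY i (parSymY i) D U ξ) (GsqY i (parSymY i) D U ξ) := trIP_self_nonneg _ (fun _ => one_pos) _
    have hsq := trIP_sq_le (fun _ => (1 : ℝ)) (fun _ => one_pos) ξ (GsqY i (parSymY i) D U ξ)
    have h3 : (trIP (fun _ => (1 : ℝ)) ξ ξ) ^ 2 ≤ (4 * ((d : ℝ) + 1) + 1) ^ 2 *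
        (trIP (fun _ => (1 : ℝ)) ξ ξ * trIP (fun _ => (1 : ℝ)) (GsqY i (parSymY i) D U ξ) (GsqY i (parSymY i) D U ξ)) := by
      calc (trIP (fun _ => (1 : ℝ)) ξ ξ) ^ 2 ≤ ((4 * ((d : ℝ) + 1) + 1) * trIP (fun _ => (1 : ℝ)) ξ (GsqY i (parSymY i) D U ξ)) ^ 2 :=
            pow_le_pow_left₀ ha hfloor 2
        _ = (4 * ((d : ℝ) + 1) + 1) ^ 2 * trIP (fun _ => (1 : ℝ)) ξ (GsqY i (parSymY i) D U ξ) ^ 2 := by ring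
        _ ≤ _ := mul_le_mul_of_nonneg_left hsq (sq_nonneg _)
    rcases ha.eq_or_lt with h0 | hpos
    · rw [← h0]; exact mul_nonneg (sq_nonneg _) hb
    · have h4 : trIP (fun _ => (1 : ℝ)) ξ ξ * trIP (fun _ => (1 : ℝ)) ξ ξ ≤ ((4 * ((d : ℝ) + 1) + 1) ^ 2 *
          trIP (fun _ => (1 : ℝ)) (GsqY i (parSymY i) D U ξ) (GsqY i (parSymY i) D U ξ)) * trIP (fun _ => (1 : ℝ)) ξ ξ := by nlinarith
      exact le_of_mul_le_mul_right h4 hpos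
  -- the isometry `‖Q′*Φ‖₁ = ‖Φ‖_W` and Pythagoras for the cut
  have hiso : trIP (fun _ => (1 : ℝ)) ξ ξ = trIP (wB i) Φ Φ := trIP_one_QpsY_self_eq i hG (parSymY i) U (fun z w => parSymY_mem i hU z w) Φ
  have hpy : trIP (wB i) Ψ Ψ = trIP (wB i) Φ Φ + trIP (wB i) Ψc Ψc := trIP_self_eq_cut_add_compl (wB i) hχ Ψ
  have hΦ0 : 0 ≤ trIP (wB i) Φ Φ := trIP_self_nonneg _ (wB_pos i) Φ
  have hΨc0 : 0 ≤ trIP (wB i) Ψc Ψc := trIP_self_nonneg _ (wB_pos i) Ψc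
  have hG' : ((4 * ((d : ℝ) + 1) + 1) ^ 2)⁻¹ * trIP (wB i) Φ Φ ≤
      trIP (fun _ => (1 : ℝ)) (GsqY i (parSymY i) D U ξ) (GsqY i (parSymY i) D U ξ) := by
    rw [← hiso, inv_mul_le_iff₀ (pow_pos hM0 2)]
    exact hcs
  calc ((4 * ((d : ℝ) + 1) + 1) ^ 2)⁻¹ * trIP (wB i) Ψ Ψ
      = ((4 * ((d : ℝ) + 1) + 1) ^ 2)⁻¹ * trIP (wB i) Φ Φ + ((4 * ((d : ℝ) + 1) + 1) ^ 2)⁻¹ * trIP (wB i) Ψc Ψc := by rw [hpy, mul_add]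
    _ ≤ trIP (fun _ => (1 : ℝ)) (GsqY i (parSymY i) D U ξ) (GsqY i (parSymY i) D U ξ) + trIP (wB i) Ψc Ψc := by
        refine add_le_add hG' ?_
        calc ((4 * ((d : ℝ) + 1) + 1) ^ 2)⁻¹ * trIP (wB i) Ψc Ψc ≤ 1 * trIP (wB i) Ψc Ψc := mul_le_mul_of_nonneg_right hMi1 hΨc0
          _ = trIP (wB i) Ψc Ψc := one_mul _

end Centre

/-! ## §2. ★★★ THE `C_□`-STATION: along ANY holomorphic background family, and along pv27's pencil at def-Y's v4 letter with the centre DISCHARGED at every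
unitary-valued background — NO displayed N06 hypothesis -/

section CStation

variable {d ℓ : ℕ} {hd : 1 ≤ d + 1} {hL : Odd (ℓ + 1) ∧ 1 < ℓ + 1} {b₀ b₁ : ℝ} {N : ℕ}
variable (i : KIdx d ℓ hd hL b₀ b₁) {G : Subgroup (Matrix (Fin N) (Fin N) ℂ)ˣ}
variable (parS : SiteParY (Matrix (Fin N) (Fin N) ℂ) i) {E : Type*} [NormedAddCommGroup E] [NormedSpace ℂ E] (F : E → CfgY (Matrix (Fin N) (Fin N) ℂ) i)
variable [DecidableEq (BlkY i)]
variable {ν : ℕ} {Nf : Fin ν → ℕ} [∀ j, NeZero (Nf j)]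

omit [DecidableEq (BlkY i)] in
/-- every block volume is at least `1`. [cite: Balaban1984PropagatorsII, (2.69) p.235, (2.3)–(2.4) p.224, bookkeeping] -/
theorem one_le_wB (s : BlkY i) : 1 ≤ wB i s := by
  have hL1 : (1 : ℝ) ≤ (ℓ : ℝ) + 1 := by linarith [Nat.cast_nonneg (α := ℝ) ℓ]
  show (1 : ℝ) ≤ B6Ineq268MultiLevelBox.W i.D.toDomains s
  rw [B6Ineq268MultiLevelBox.W_eq]
  exact one_le_pow₀ (one_le_pow₀ hL1)

omit [DecidableEq (BlkY i)] in
/-- every block volume is at most `(L^k)^{d+1}`. [cite: Balaban1984PropagatorsII, (2.69) p.235, (2.3)–(2.4) p.224, bookkeeping] -/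
theorem wB_le_pow (s : BlkY i) : wB i s ≤ (((ℓ : ℝ) + 1) ^ i.k) ^ (d + 1) := by
  have hs := (B6Geom246MultiLevelBox.scale_bounds i.D.toDomains s).2
  have hL1 : (1 : ℝ) ≤ (ℓ : ℝ) + 1 := by linarith [Nat.cast_nonneg (α := ℝ) ℓ]
  show B6Ineq268MultiLevelBox.W i.D.toDomains s ≤ _
  rw [B6Ineq268MultiLevelBox.W_eq]
  exact pow_le_pow_left₀ (by positivity) (pow_le_pow_right₀ hL1 hs) _

omit [DecidableEq (BlkY i)] in
/-- the weight numeral `√W ≤ Θ := √((L^k)^{d+1})` (module 81's ratio numeral, p613219's `sqrt_wB_le_mul_sqrt_wB` in absolute form).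
[cite: Balaban1984PropagatorsII, (2.69) p.235; Balaban1985BackgroundPropagators, (3.48) p.398, bookkeeping] -/
theorem sqrt_wB_le (s : BlkY i) : Real.sqrt (wB i s) ≤ Real.sqrt ((((ℓ : ℝ) + 1) ^ i.k) ^ (d + 1)) :=
  Real.sqrt_le_sqrt (wB_le_pow i s)

omit [DecidableEq (BlkY i)] in
/-- the weight numeral `1∕√W ≤ 1`. [cite: Balaban1984PropagatorsII, (2.69) p.235, bookkeeping] -/
theorem inv_sqrt_wB_le_one (s : BlkY i) : (Real.sqrt (wB i s))⁻¹ ≤ 1 :=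
  inv_le_one_of_one_le₀ (Real.one_le_sqrt.2 (one_le_wB i s))

/-- ★★★ **THE `C_□`-STATION ALONG ANY HOLOMORPHIC BACKGROUND FAMILY** (`𝔸 = M_N(ℂ)`, matrix-unit product bases; ANY `parS`, ANY site set `D`, ANY 0∕1 block cut `χ`):
from the letters of `u ↦ X_□(F u) = Q′G′_□²Q′*(F u)` on blocks `(R, ρ, B_X)` (§4 from L1's `hG`), a fibre bound `m_B` of the block reading, the centre's coercivity
`m·⟨Ψ,Ψ⟩_W ≤ ⟨Ψ, (M_χ X_□(F 0) M_χ + 1 − M_χ)Ψ⟩_W` in the BLOCK-VOLUME pairing (displayed; = §2 at `parSymY` and a unitary `F 0`), and the window (`Θ = √((L^k)^{d+1})`,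
margin `m′ = m − 2·((Θ·1·(B_X+1))·(m_B·c₀(1,ρ)^ν))·R′∕R > 0`, `0 ≤ κ ≤ ρ∕4`, `8·(Θ·1·(B_X+1))·κ·(m_B·c₀(1,ρ∕2)^ν) ≤ m′·ρ`):
`RawEntryLetters (u ↦ toMatrix B_B B_B (ClocY i parS D (M_χ) (F u))) (ℓB ∘ fst) R′ κ (1·Θ·(4∕m′))` — w6's L3 INPUT `hC` verbatim at `P := cutMulY χ`.
[cite: Balaban1985BackgroundPropagators, (3.79) p.406, (3.87) p.409 (C_□ = (Q′G′_□²Q′*)⁻¹), (3.95)–(3.96) p.411, Thm 3.2 (3.48) p.398, Thm 3.4 p.400, Thm 3.10 (3.108) p.416,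
Thm 3.11 p.416; Balaban1988RG2Cluster, (2.5)–(2.7) pp.12–13, p.15; Balaban1984PropagatorsII, Lemma 2.1 (2.61) p.234, (2.69) p.235; AizenmanWarzel2015, §10.3] -/
theorem rawEntryLetters_toMatrix_ClocY_of_family (D : Finset (SiteY i)) {χ : BlkY i → ℝ} (hχ : ∀ s, χ s = 0 ∨ χ s = 1)
    (ℓB : BlkY i → UT Nf) {R R' ρ BX m : ℝ}
    (hX : RawEntryLetters (fun u : E =>
      LinearMap.toMatrix
        ((Pi.basis fun _ : BlkY i => Matrix.stdBasis ℂ (Fin N) (Fin N)).reindex (Equiv.sigmaEquivProd (BlkY i) (Fin N × Fin N)))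
        ((Pi.basis fun _ : BlkY i => Matrix.stdBasis ℂ (Fin N) (Fin N)).reindex (Equiv.sigmaEquivProd (BlkY i) (Fin N × Fin N)))
        (XY i parS (GsqY i parS D) (F u))) (fun p : BlkY i × (Fin N × Fin N) => ℓB p.1) R ρ BX)
    (hρ : 0 < ρ) {mB : ℕ} (hfibB : ∀ y : UT Nf, (univ.filter fun p : BlkY i × (Fin N × Fin N) => ℓB p.1 = y).card ≤ mB)
    (hco : ∀ Ψ : BlkY i → Matrix (Fin N) (Fin N) ℂ, m * trIP (wB i) Ψ Ψ ≤ trIP (wB i) Ψ (padXlocY i parS D (cutMulY χ) (F 0) Ψ))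
    (hR' : 0 ≤ R') (hR'R : R' ≤ R)
    (hmarg : 0 < m - 2 * ((Real.sqrt ((((ℓ : ℝ) + 1) ^ i.k) ^ (d + 1)) * 1 * (BX + 1)) * (mB * B6.c0 1 ρ ^ ν)) * R' / R)
    {κ : ℝ} (hκ : 0 ≤ κ) (hκ4 : κ ≤ ρ / 4)
    (hκm : 8 * (Real.sqrt ((((ℓ : ℝ) + 1) ^ i.k) ^ (d + 1)) * 1 * (BX + 1)) * κ * (mB * B6.c0 1 (ρ / 2) ^ ν) ≤
      (m - 2 * ((Real.sqrt ((((ℓ : ℝ) + 1) ^ i.k) ^ (d + 1)) * 1 * (BX + 1)) * (mB * B6.c0 1 ρ ^ ν)) * R' / R) * ρ) :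
    RawEntryLetters (fun u : E =>
        LinearMap.toMatrix
          ((Pi.basis fun _ : BlkY i => Matrix.stdBasis ℂ (Fin N) (Fin N)).reindex (Equiv.sigmaEquivProd (BlkY i) (Fin N × Fin N)))
          ((Pi.basis fun _ : BlkY i => Matrix.stdBasis ℂ (Fin N) (Fin N)).reindex (Equiv.sigmaEquivProd (BlkY i) (Fin N × Fin N)))
          (ClocY i parS D (cutMulY χ) (F u))) (fun p : BlkY i × (Fin N × Fin N) => ℓB p.1) R'
      κ (1 * Real.sqrt ((((ℓ : ℝ) + 1) ^ i.k) ^ (d + 1)) *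
        (4 / (m - 2 * ((Real.sqrt ((((ℓ : ℝ) + 1) ^ i.k) ^ (d + 1)) * 1 * (BX + 1)) * (mB * B6.c0 1 ρ ^ ν)) * R' / R))) :=
  rawEntryLetters_toMatrix_dirInvY_of_coer_compression_letters_weighted _ hχ hX hρ hfibB (wB_pos i) (Real.sqrt_nonneg _) zero_le_one
    (sqrt_wB_le i) (inv_sqrt_wB_le_one i) hco hR' hR'R hmarg hκ hκ4 hκm

/-- ★★★ **THE `C_□`-STATION ALONG pv27's PENCIL AT def-Y's v4 LETTER, CENTRE DISCHARGED**: at EVERY `G`-valued background `U₀` (`G ≤ U(N)`) and every block set `Dblk` whose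
sites lie in `D`, from the pencil letters of `A′ ↦ X_□(e^{iηA′}U₀)` on blocks `(R, ρ, B_X)` (displayed), a fibre bound and the window with `m = (4(d+1)+1)⁻²` (§2):
`RawEntryLetters (A′ ↦ toMatrix B_B B_B (ClocY i parSymY D (M_{𝟙_Dblk}) (e^{iηA′}U₀))) (ℓB ∘ fst) R′ κ (1·Θ·(4∕m′))` — NO (3.35), NO N06 input: the local inverse
`C_□ = (Q′G′_□²Q′*)⁻¹` on the cube's blocks exists and carries (3.108)-letters along the pencil around every unitary background.
[cite: Balaban1985BackgroundPropagators, (3.25) p.394, (3.87) p.409, (3.95)–(3.96) p.411, Thm 3.2 (3.48) p.398, Thm 3.4 p.400, Thm 3.10 (3.108) p.416, Thm 3.11 p.416;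
Balaban1984PropagatorsI, p.25; Balaban1984PropagatorsII, Prop 2.3 p.238, Lemma 2.1 (2.61) p.234; Balaban1988RG2Cluster, (2.5)–(2.7) pp.12–13, p.15] -/
theorem rawEntryLetters_toMatrix_ClocY_parSymY_prodCfg_of_XLetters (hG : G ≤ B7Prop2Explicit.unitaryUnits (Matrix (Fin N) (Fin N) ℂ))
    {U₀ : CfgY (Matrix (Fin N) (Fin N) ℂ) i} (hU : ∀ μ x, U₀ μ x ∈ G) (η : ℝ) (D : Finset (SiteY i)) {Dblk : Finset (BlkY i)}
    (hDD : ∀ z : SiteY i, blkOf i.D.toDomains z ∈ Dblk → z ∈ D) (ℓB : BlkY i → UT Nf) {R R' ρ BX : ℝ}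
    (hX : RawEntryLetters (fun a : Fin (d + 1) → Site (PV d ℓ i.m i.K hd hL) 0 → Matrix (Fin N) (Fin N) ℂ =>
      LinearMap.toMatrix
        ((Pi.basis fun _ : BlkY i => Matrix.stdBasis ℂ (Fin N) (Fin N)).reindex (Equiv.sigmaEquivProd (BlkY i) (Fin N × Fin N)))
        ((Pi.basis fun _ : BlkY i => Matrix.stdBasis ℂ (Fin N) (Fin N)).reindex (Equiv.sigmaEquivProd (BlkY i) (Fin N × Fin N)))
        (XY i (parSymY i) (GsqY i (parSymY i) D) (prodCfg U₀ η a))) (fun p : BlkY i × (Fin N × Fin N) => ℓB p.1) R ρ BX)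
    (hρ : 0 < ρ) {mB : ℕ} (hfibB : ∀ y : UT Nf, (univ.filter fun p : BlkY i × (Fin N × Fin N) => ℓB p.1 = y).card ≤ mB)
    (hR' : 0 ≤ R') (hR'R : R' ≤ R)
    (hmarg : 0 < ((4 * ((d : ℝ) + 1) + 1) ^ 2)⁻¹ -
      2 * ((Real.sqrt ((((ℓ : ℝ) + 1) ^ i.k) ^ (d + 1)) * 1 * (BX + 1)) * (mB * B6.c0 1 ρ ^ ν)) * R' / R)
    {κ : ℝ} (hκ : 0 ≤ κ) (hκ4 : κ ≤ ρ / 4)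
    (hκm : 8 * (Real.sqrt ((((ℓ : ℝ) + 1) ^ i.k) ^ (d + 1)) * 1 * (BX + 1)) * κ * (mB * B6.c0 1 (ρ / 2) ^ ν) ≤
      (((4 * ((d : ℝ) + 1) + 1) ^ 2)⁻¹ - 2 * ((Real.sqrt ((((ℓ : ℝ) + 1) ^ i.k) ^ (d + 1)) * 1 * (BX + 1)) * (mB * B6.c0 1 ρ ^ ν)) * R' / R) * ρ) :
    RawEntryLetters (fun a : Fin (d + 1) → Site (PV d ℓ i.m i.K hd hL) 0 → Matrix (Fin N) (Fin N) ℂ =>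
        LinearMap.toMatrix
          ((Pi.basis fun _ : BlkY i => Matrix.stdBasis ℂ (Fin N) (Fin N)).reindex (Equiv.sigmaEquivProd (BlkY i) (Fin N × Fin N)))
          ((Pi.basis fun _ : BlkY i => Matrix.stdBasis ℂ (Fin N) (Fin N)).reindex (Equiv.sigmaEquivProd (BlkY i) (Fin N × Fin N)))
          (ClocY i (parSymY i) D (cutMulY (blkIndY i Dblk)) (prodCfg U₀ η a))) (fun p : BlkY i × (Fin N × Fin N) => ℓB p.1) R'
      κ (1 * Real.sqrt ((((ℓ : ℝ) + 1) ^ i.k) ^ (d + 1)) *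
        (4 / (((4 * ((d : ℝ) + 1) + 1) ^ 2)⁻¹ -
          2 * ((Real.sqrt ((((ℓ : ℝ) + 1) ^ i.k) ^ (d + 1)) * 1 * (BX + 1)) * (mB * B6.c0 1 ρ ^ ν)) * R' / R))) := by
  have hco : ∀ Ψ : BlkY i → Matrix (Fin N) (Fin N) ℂ, ((4 * ((d : ℝ) + 1) + 1) ^ 2)⁻¹ * trIP (wB i) Ψ Ψ ≤
      trIP (wB i) Ψ (padXlocY i (parSymY i) D (cutMulY (blkIndY i Dblk)) (prodCfg U₀ η 0) Ψ) := fun Ψ => by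
    rw [prodCfg_zero]; exact trIP_padXlocY_parSymY_ge i hG hU hDD Ψ
  exact rawEntryLetters_toMatrix_ClocY_of_family i (parSymY i) (fun a => prodCfg U₀ η a) D (blkIndY_zero_one i Dblk) ℓB hX hρ hfibB hco
    hR' hR'R hmarg hκ hκ4 hκm

/-- ★★★ **THE `C_□`-STATION FED BY `G′_□`'s PENCIL LETTERS** (L1's OUTPUT `hG` ⟹ w6's L3 INPUT `hC`, at def-Y's v4 letter, EVERY `G`-valued `U₀`, `G ≤ U(N)`, `1 ≤ N`):
DISPLAYED — `G′_□`'s pencil letters `(R, ρ, B_G′)` on sites (`0 < R ≤ Rc`), NODE 00's dictionary numerals `Dq, CQ, CQs, r` of the averaging kernels and readings,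
fibre bounds `m_S, m_B`, a rate loss `0 < μ < ρ`, radii `0 ≤ R′ ≤ R`, one rate `κ` with the window at `m = (4(d+1)+1)⁻²`; the X-constant `B_X` is bound ONCE by the
equation `hBX` (`rfl` at the call site): `RawEntryLetters (A′ ↦ toMatrix B_B B_B (C_□(e^{iηA′}U₀))) (ℓB ∘ fst) R′ κ (1·Θ·(4∕m′))` — §4 at the v4 transporter facts
(78 §1, size numeral `K₀ = 1` by unitarity) then the previous theorem.  NO (3.35), NO N06 input.
[cite: Balaban1985BackgroundPropagators, (3.25) p.394, (3.87) p.409, (3.95)–(3.96) p.411, Thm 3.2 (3.48) p.398, Thm 3.4 p.400, (3.66)–(3.70) pp.403–404, Thm 3.10 (3.108)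
p.416, Thm 3.11 p.416; Balaban1984PropagatorsI, p.25; Balaban1984PropagatorsII, Prop 2.3 p.238, (2.54) p.232, Lemma 2.1 (2.61) p.234; Balaban1988RG2Cluster, (2.5)–(2.7) pp.12–13, p.15] -/
theorem rawEntryLetters_toMatrix_ClocY_parSymY_prodCfg_of_GsqLetters [NeZero N]
    (hG : G ≤ B7Prop2Explicit.unitaryUnits (Matrix (Fin N) (Fin N) ℂ))
    {U₀ : CfgY (Matrix (Fin N) (Fin N) ℂ) i} (hU : ∀ μ x, U₀ μ x ∈ G) (η : ℝ) (D : Finset (SiteY i)) {Dblk : Finset (BlkY i)}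
    (hDD : ∀ z : SiteY i, blkOf i.D.toDomains z ∈ Dblk → z ∈ D)
    {R Rc : ℝ} (hR : 0 < R) (hRRc : R ≤ Rc) {Dq : ℕ}
    (hD : ∀ s z, qpK i s z ≠ 0 → Site.tdist ((boxEquiv i.hN).symm (blkCornerY i s)) ((boxEquiv i.hN).symm z) ≤ Dq)
    (hDs : ∀ z s, qpsK i z s ≠ 0 → Site.tdist ((boxEquiv i.hN).symm (blkCornerY i s)) ((boxEquiv i.hN).symm z) ≤ Dq)
    {CQ CQs : ℝ} (hCQ0 : 0 ≤ CQ) (hCQ : ∀ s, ∑ z, |qpK i s z| ≤ CQ) (hCQs0 : 0 ≤ CQs) (hCQs : ∀ s, ∑ z, |qpsK i z s| ≤ CQs)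
    (ℓS : SiteY i → UT Nf) (ℓB : BlkY i → UT Nf) {r : ℝ}
    (hℓQ : ∀ s z, qpK i s z ≠ 0 → tdist1 Nf (ℓB s) (ℓS z) ≤ r) (hℓQs : ∀ z s, qpsK i z s ≠ 0 → tdist1 Nf (ℓS z) (ℓB s) ≤ r)
    {mS mB : ℕ} (hfibS : ∀ y : UT Nf, (univ.filter fun q : SiteY i × (Fin N × Fin N) => ℓS q.1 = y).card ≤ mS)
    (hfibB : ∀ y : UT Nf, (univ.filter fun p : BlkY i × (Fin N × Fin N) => ℓB p.1 = y).card ≤ mB)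
    {ρ BG μ : ℝ}
    (hGsq : RawEntryLetters (fun a : Fin (d + 1) → Site (PV d ℓ i.m i.K hd hL) 0 → Matrix (Fin N) (Fin N) ℂ =>
      LinearMap.toMatrix
        ((Pi.basis fun _ : SiteY i => Matrix.stdBasis ℂ (Fin N) (Fin N)).reindex (Equiv.sigmaEquivProd (SiteY i) (Fin N × Fin N)))
        ((Pi.basis fun _ : SiteY i => Matrix.stdBasis ℂ (Fin N) (Fin N)).reindex (Equiv.sigmaEquivProd (SiteY i) (Fin N × Fin N)))
        (GsqY i (parSymY i) D (prodCfg U₀ η a))) (fun q : SiteY i × (Fin N × Fin N) => ℓS q.1) R ρ BG)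
    (hμ : 0 < μ) (hμρ : μ < ρ)
    {BX : ℝ} (hBX : BX = CQ * (Fintype.card (Fin N × Fin N) : ℝ) * (1 * ((1 * Real.exp (|η| * Rc)) ^ Dq * 1 * (1 * Real.exp (|η| * Rc)) ^ Dq)) *
        (CQs * (Fintype.card (Fin N × Fin N) : ℝ) * (1 * ((1 * Real.exp (|η| * Rc)) ^ Dq * 1 * (1 * Real.exp (|η| * Rc)) ^ Dq))) *
        (BG * BG * (mS * B6.c0 1 μ ^ ν)) * Real.exp (2 * (ρ - μ) * r))
    {R' : ℝ} (hR' : 0 ≤ R') (hR'R : R' ≤ R)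
    (hmarg : 0 < ((4 * ((d : ℝ) + 1) + 1) ^ 2)⁻¹ -
      2 * ((Real.sqrt ((((ℓ : ℝ) + 1) ^ i.k) ^ (d + 1)) * 1 * (BX + 1)) * (mB * B6.c0 1 (ρ - μ) ^ ν)) * R' / R)
    {κ : ℝ} (hκ : 0 ≤ κ) (hκ4 : κ ≤ (ρ - μ) / 4)
    (hκm : 8 * (Real.sqrt ((((ℓ : ℝ) + 1) ^ i.k) ^ (d + 1)) * 1 * (BX + 1)) * κ * (mB * B6.c0 1 ((ρ - μ) / 2) ^ ν) ≤
      (((4 * ((d : ℝ) + 1) + 1) ^ 2)⁻¹ - 2 * ((Real.sqrt ((((ℓ : ℝ) + 1) ^ i.k) ^ (d + 1)) * 1 * (BX + 1)) * (mB * B6.c0 1 (ρ - μ) ^ ν)) * R' / R) *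
        (ρ - μ)) :
    RawEntryLetters (fun a : Fin (d + 1) → Site (PV d ℓ i.m i.K hd hL) 0 → Matrix (Fin N) (Fin N) ℂ =>
        LinearMap.toMatrix
          ((Pi.basis fun _ : BlkY i => Matrix.stdBasis ℂ (Fin N) (Fin N)).reindex (Equiv.sigmaEquivProd (BlkY i) (Fin N × Fin N)))
          ((Pi.basis fun _ : BlkY i => Matrix.stdBasis ℂ (Fin N) (Fin N)).reindex (Equiv.sigmaEquivProd (BlkY i) (Fin N × Fin N)))
          (ClocY i (parSymY i) D (cutMulY (blkIndY i Dblk)) (prodCfg U₀ η a))) (fun p : BlkY i × (Fin N × Fin N) => ℓB p.1) R'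
      κ (1 * Real.sqrt ((((ℓ : ℝ) + 1) ^ i.k) ^ (d + 1)) *
        (4 / (((4 * ((d : ℝ) + 1) + 1) ^ 2)⁻¹ -
          2 * ((Real.sqrt ((((ℓ : ℝ) + 1) ^ i.k) ^ (d + 1)) * 1 * (BX + 1)) * (mB * B6.c0 1 (ρ - μ) ^ ν)) * R' / R))) := by
  have hX := rawEntryLetters_toMatrix_XY_parSymY_prodCfg_of_mem i hG hU (GsqY i (parSymY i) D) η hR hRRc hD hDs hCQ0 hCQ hCQs0 hCQs ℓS ℓB
    hℓQ hℓQs hfibS hGsq hμ hμρ.le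
  rw [← hBX] at hX
  exact rawEntryLetters_toMatrix_ClocY_parSymY_prodCfg_of_XLetters i hG hU η D hDD ℓB hX (by linarith) hfibB hR' hR'R hmarg hκ hκ4 hκm

end CStation

end Literature.MathematicalPhysics.QuantumFieldTheory.Balaban1983to89.B13DirichletLocalCLetters

end
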